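import Summits.CriticalPhenomena.PercolationContinuityZ3.Theorems.PercNearOneGluingNoHeavyLowerTailTwoCopyMonotoneBridge

/-!
# Two-weight (monotone-coupling) fibre bridge for two-map kernel theorems (four marked points, all `n`, two weightings `w' ≤ w`)

Support file for crux `stmt-CriticalPhenomena-4575` (master-family programme, quadratic four-point row `Q44b` and its pencil /
two-weight companions), seat `prim-l12-p6` gen 19; memos `run/shared/lean/prim/prim-l12/FROM-prim-l12-p6-g14-OTA-KERNEL-AND-COMB3.md`
§1(c) (the law-level reading left unformalised there) and `FROM-prim-l12-p6-g19-TWO-WEIGHT-KERNEL.md`.  Companion of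
`…TwoCopyMonotoneBridge` (ONE weighting, ONE monotone profile map): here TWO weightings `w' ≤ w` and the ORIENTED two-map count.

* The TWO-MAP PROPERTY of a cell kernel `κ` (hypothesis of `sum_kernel_cell₂_nonneg`, written out; no definition is introduced):
  `0 ≤ Σ_T κ(τ T, σ Tᶜ)` for all nested monotone equivalence-valued profile maps `σ ≤ τ` on the subsets of a finite type (heavy cell read
  by the bigger map; the nine-type kernels have it — `…NineTypeTwoMapCount`, `TwoCopyMono.kerS_twoMap_prof` in the companion file
  `…Q44bTwoWeightMonotone`).
* **`TwoCopyMono.sum_kernel_cell₂_eq_fibres`** — the TWO-WEIGHT fibre expansion (an identity, any kernel, any two weightings):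
  `Σ_{i,j} κ i j · cell_w i · cell_{w'} j = Σ_M Σ_{C ⊆ Mᶜ} Σ_{F ⊆ M} exc(F) · wt3(M,C,F) · Σ_{T ⊆ M∖F} κ(prof(C∪(F∪T)), prof(C∪((M∖F)∖T)))`,
  `exc(F) = Π_{e∈F} (w_e − w'_e)`, `wt3(M,C,F) = Π_C w w' · Π_F 1 · Π_{M∖F} (1−w)w' · Π_{rest} (1−w)(1−w') ≥ 0` (both written out as products).  Mechanism: expand both cells over configurations `(S, S')` (`sum_kernel_cell₂_eq_pairs`), pass to
  the fibres `(M, C, T) = (S ∆ S', S ∩ S', S ∖ S')` (`sum_pairs_eq_sum_fibres`), and on each fibre split the weight of the `S`-only coordinates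
  `w_e(1 − w'_e) = (w_e − w'_e) + (1 − w_e)w'_e` coordinatewise (`Finset.prod_add`): the coordinates taking the excess form a set `F` forced into the
  heavy copy, the rest of the fibre weight is symmetric (`wt3`), and what is left is the two-map count for `τ = prof(C ∪ F ∪ ·) ≥ σ = prof(C ∪ ·)`.
* **`TwoCopyMono.sum_kernel_cell₂_nonneg`** — hence for a kernel with the two-map property and `w' ≤ w` coordinatewise the two-weight
  bilinear cell form (heavy cells at the bigger weights) is `≥ 0` on every finite weighted graph, for all marked points.
No named facts, no sorries, no new definitions.
-/

noncomputable section

namespace Summit.CriticalPhenomena.PercolationContinuityZ3.Theorems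

open MeasureTheory Set Finset Literature.Probability.Percolation
open Literature.Probability.LatticeModels (prodBernoulli)
open Summit.CriticalPhenomena.PercolationContinuityZ3.Cruxes.AdditiveGluing.TieLine.ConnAtoms

namespace TwoCopyMono

open FourPointAtoms

variable {n : ℕ}

/-! ## The two-weight pair expansion -/

/-- The two-weight bilinear cell form as a sum over pairs of configurations. [this work] -/
theorem sum_kernel_cell₂_eq_pairs (κ : Fin 15 → Fin 15 → ℤ) (w w' : Sym2 (Fin n) → unitInterval) (a b c y : Fin n) :
    (∑ i : Fin 15, ∑ j : Fin 15, (κ i j : ℝ) * FourPointAtoms.cell w a b c y i * FourPointAtoms.cell w' a b c y j) =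
      ∑ S : Finset (Sym2 (Fin n)), ∑ S' : Finset (Sym2 (Fin n)),
        (liftK κ (prof a b c y ↑S) (prof a b c y ↑S') : ℝ) * (wt w S * wt w' S') := by
  classical
  set X : Fin 15 → Fin 15 → Finset (Sym2 (Fin n)) → Finset (Sym2 (Fin n)) → ℝ := fun i j S S' =>
    (if prof a b c y ↑S = profOf (FourPointAtoms.pat4 i) ∧ prof a b c y ↑S' = profOf (FourPointAtoms.pat4 j)
      then (κ i j : ℝ) else 0) * (wt w S * wt w' S') with hX
  have hL : (∑ i : Fin 15, ∑ j : Fin 15, (κ i j : ℝ) * FourPointAtoms.cell w a b c y i * FourPointAtoms.cell w' a b c y j)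
      = ∑ i : Fin 15, ∑ j : Fin 15, ∑ S : Finset (Sym2 (Fin n)), ∑ S' : Finset (Sym2 (Fin n)), X i j S S' := by
    refine Finset.sum_congr rfl fun i _ => Finset.sum_congr rfl fun j _ => ?_
    rw [cell_eq_sum w, cell_eq_sum w', mul_assoc, Finset.sum_mul_sum]
    simp only [Finset.mul_sum]
    refine Finset.sum_congr rfl fun S _ => Finset.sum_congr rfl fun S' _ => ?_
    rw [hX]
    by_cases h1 : prof a b c y ↑S = profOf (FourPointAtoms.pat4 i) <;>
      by_cases h2 : prof a b c y ↑S' = profOf (FourPointAtoms.pat4 j) <;> simp [h1, h2]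
  have hR : (∑ S : Finset (Sym2 (Fin n)), ∑ S' : Finset (Sym2 (Fin n)),
        (liftK κ (prof a b c y ↑S) (prof a b c y ↑S') : ℝ) * (wt w S * wt w' S'))
      = ∑ S : Finset (Sym2 (Fin n)), ∑ S' : Finset (Sym2 (Fin n)), ∑ i : Fin 15, ∑ j : Fin 15, X i j S S' := by
    refine Finset.sum_congr rfl fun S _ => Finset.sum_congr rfl fun S' _ => ?_
    unfold liftK
    push_cast
    simp only [Finset.sum_mul, hX]
  rw [hL, hR]
  calc (∑ i : Fin 15, ∑ j : Fin 15, ∑ S : Finset (Sym2 (Fin n)), ∑ S' : Finset (Sym2 (Fin n)), X i j S S')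
      = ∑ i : Fin 15, ∑ S : Finset (Sym2 (Fin n)), ∑ S' : Finset (Sym2 (Fin n)), ∑ j : Fin 15, X i j S S' := by
        refine Finset.sum_congr rfl fun i _ => ?_
        rw [Finset.sum_comm]
        refine Finset.sum_congr rfl fun S _ => ?_
        rw [Finset.sum_comm]
    _ = ∑ S : Finset (Sym2 (Fin n)), ∑ S' : Finset (Sym2 (Fin n)), ∑ i : Fin 15, ∑ j : Fin 15, X i j S S' := by
        rw [Finset.sum_comm]
        refine Finset.sum_congr rfl fun S _ => ?_
        rw [Finset.sum_comm]

/-! ## Fibre weights for two weightings -/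

/-- The excess weight is nonnegative when `w' ≤ w`. [this work] -/
theorem exc_nonneg {w w' : Sym2 (Fin n) → unitInterval} (hle : ∀ e, w' e ≤ w e) (F : Finset (Sym2 (Fin n))) :
    0 ≤ (∏ f ∈ F, ((w f : ℝ) - (w' f : ℝ))) := by
  refine Finset.prod_nonneg fun f _ => ?_
  have h : (w' f : ℝ) ≤ (w f : ℝ) := hle f
  linarith

/-- Fibre weights are nonnegative. [this work] -/
theorem wt3_nonneg (w w' : Sym2 (Fin n) → unitInterval) (M C F : Finset (Sym2 (Fin n))) :
    0 ≤ (∏ e : Sym2 (Fin n), (if e ∈ C then (w e : ℝ) * (w' e : ℝ) else if e ∈ F then (1 : ℝ) else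
        if e ∈ M then (1 - (w e : ℝ)) * (w' e : ℝ) else (1 - (w e : ℝ)) * (1 - (w' e : ℝ)))) := by
  refine Finset.prod_nonneg fun e _ => ?_
  have h0 := (w e).2.1; have h1 := (w e).2.2; have h0' := (w' e).2.1; have h1' := (w' e).2.2
  split_ifs <;> nlinarith

/-- The two-weight pair weight on the fibre `(M, C)` at the point `T ⊆ M`, as one product. [this work] -/
theorem wt_pair_eq₂ (w w' : Sym2 (Fin n) → unitInterval) (M C T : Finset (Sym2 (Fin n))) :
    wt w (C ∪ T) * wt w' (C ∪ (M \ T)) =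
      ∏ e : Sym2 (Fin n), (if e ∈ C then (w e : ℝ) * (w' e : ℝ) else if e ∈ T then (w e : ℝ) * (1 - (w' e : ℝ)) else
        if e ∈ M then (1 - (w e : ℝ)) * (w' e : ℝ) else (1 - (w e : ℝ)) * (1 - (w' e : ℝ))) := by
  unfold wt
  rw [← Finset.prod_mul_distrib]
  refine Finset.prod_congr rfl fun e _ => ?_
  by_cases hC : e ∈ C
  · rw [if_pos (Finset.mem_union_left _ hC), if_pos (Finset.mem_union_left _ hC), if_pos hC]
  · by_cases hTe : e ∈ T
    · have h1 : e ∈ C ∪ T := Finset.mem_union_right _ hTe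
      have h2 : e ∉ C ∪ (M \ T) := by
        rw [Finset.mem_union, not_or, Finset.mem_sdiff, not_and, not_not]; exact ⟨hC, fun _ => hTe⟩
      rw [if_pos h1, if_neg h2, if_neg hC, if_pos hTe]
    · have h1 : e ∉ C ∪ T := by rw [Finset.mem_union, not_or]; exact ⟨hC, hTe⟩
      by_cases hM : e ∈ M
      · have h2 : e ∈ C ∪ (M \ T) := Finset.mem_union_right _ (Finset.mem_sdiff.2 ⟨hM, hTe⟩)
        rw [if_neg h1, if_pos h2, if_neg hC, if_neg hTe, if_pos hM]
      · have h2 : e ∉ C ∪ (M \ T) := by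
          rw [Finset.mem_union, not_or, Finset.mem_sdiff, not_and]; exact ⟨hC, fun h => absurd h hM⟩
        rw [if_neg h1, if_neg h2, if_neg hC, if_neg hTe, if_neg hM]

/-- Splitting off the `S`-only coordinates: the pair weight is `Π_{e∈T} w_e(1−w'_e)` times the fibre weight `wt3 M C T`. [this work] -/
theorem wt_pair_eq_mul_wt3 (w w' : Sym2 (Fin n) → unitInterval) {M C T : Finset (Sym2 (Fin n))}
    (hCT : Disjoint C T) :
    wt w (C ∪ T) * wt w' (C ∪ (M \ T)) = (∏ e ∈ T, (w e : ℝ) * (1 - (w' e : ℝ))) *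
      (∏ e : Sym2 (Fin n), (if e ∈ C then (w e : ℝ) * (w' e : ℝ) else if e ∈ T then (1 : ℝ) else
        if e ∈ M then (1 - (w e : ℝ)) * (w' e : ℝ) else (1 - (w e : ℝ)) * (1 - (w' e : ℝ)))) := by
  rw [wt_pair_eq₂ w w' M C T]
  rw [← Finset.prod_mul_prod_compl T]
  rw [← Finset.prod_mul_prod_compl T (f := fun e => if e ∈ C then (w e : ℝ) * (w' e : ℝ) else if e ∈ T then 1 else
    if e ∈ M then (1 - (w e : ℝ)) * (w' e : ℝ) else (1 - (w e : ℝ)) * (1 - (w' e : ℝ)))]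
  have hA : (∏ e ∈ T, (if e ∈ C then (w e : ℝ) * (w' e : ℝ) else if e ∈ T then (w e : ℝ) * (1 - (w' e : ℝ)) else
      if e ∈ M then (1 - (w e : ℝ)) * (w' e : ℝ) else (1 - (w e : ℝ)) * (1 - (w' e : ℝ)))) =
      ∏ e ∈ T, (w e : ℝ) * (1 - (w' e : ℝ)) := by
    refine Finset.prod_congr rfl fun e he => ?_
    have hC : e ∉ C := fun h => (Finset.disjoint_left.1 hCT h) he
    rw [if_neg hC, if_pos he]
  have hB : (∏ e ∈ T, (if e ∈ C then (w e : ℝ) * (w' e : ℝ) else if e ∈ T then 1 else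
      if e ∈ M then (1 - (w e : ℝ)) * (w' e : ℝ) else (1 - (w e : ℝ)) * (1 - (w' e : ℝ)))) = 1 := by
    refine Finset.prod_eq_one fun e he => ?_
    have hC : e ∉ C := fun h => (Finset.disjoint_left.1 hCT h) he
    rw [if_neg hC, if_pos he]
  have hC' : (∏ e ∈ Tᶜ, (if e ∈ C then (w e : ℝ) * (w' e : ℝ) else if e ∈ T then (w e : ℝ) * (1 - (w' e : ℝ)) else
      if e ∈ M then (1 - (w e : ℝ)) * (w' e : ℝ) else (1 - (w e : ℝ)) * (1 - (w' e : ℝ)))) =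
      ∏ e ∈ Tᶜ, (if e ∈ C then (w e : ℝ) * (w' e : ℝ) else if e ∈ T then 1 else
      if e ∈ M then (1 - (w e : ℝ)) * (w' e : ℝ) else (1 - (w e : ℝ)) * (1 - (w' e : ℝ))) := by
    refine Finset.prod_congr rfl fun e he => ?_
    rw [Finset.mem_compl] at he
    rw [if_neg he, if_neg he]
  rw [hA, hB, hC']; ring

/-- Refining a fibre: for `F ⊆ T` the fibre weight at `F` is the one at `T` times `Π_{T∖F} (1−w)w'`. [this work] -/
theorem wt3_eq_mul (w w' : Sym2 (Fin n) → unitInterval) {M C T F : Finset (Sym2 (Fin n))} (hT : T ⊆ M)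
    (hCT : Disjoint C T) (hF : F ⊆ T) :
    (∏ e : Sym2 (Fin n), (if e ∈ C then (w e : ℝ) * (w' e : ℝ) else if e ∈ F then (1 : ℝ) else
        if e ∈ M then (1 - (w e : ℝ)) * (w' e : ℝ) else (1 - (w e : ℝ)) * (1 - (w' e : ℝ)))) =
      (∏ e ∈ T \ F, (1 - (w e : ℝ)) * (w' e : ℝ)) *
      (∏ e : Sym2 (Fin n), (if e ∈ C then (w e : ℝ) * (w' e : ℝ) else if e ∈ T then (1 : ℝ) else
        if e ∈ M then (1 - (w e : ℝ)) * (w' e : ℝ) else (1 - (w e : ℝ)) * (1 - (w' e : ℝ)))) := by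
  have hsplit : (∏ e ∈ T \ F, (1 - (w e : ℝ)) * (w' e : ℝ)) =
      ∏ e : Sym2 (Fin n), (if e ∈ T \ F then (1 - (w e : ℝ)) * (w' e : ℝ) else 1) := by
    rw [Finset.prod_ite_mem, Finset.univ_inter]
  rw [hsplit, ← Finset.prod_mul_distrib]
  refine Finset.prod_congr rfl fun e _ => ?_
  by_cases hC : e ∈ C
  · have h1 : e ∉ T \ F := fun h => (Finset.disjoint_left.1 hCT hC) (Finset.mem_sdiff.1 h).1
    rw [if_pos hC, if_pos hC, if_neg h1, one_mul]
  · rw [if_neg hC, if_neg hC]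
    by_cases hFe : e ∈ F
    · have h1 : e ∉ T \ F := fun h => (Finset.mem_sdiff.1 h).2 hFe
      rw [if_pos hFe, if_neg h1, if_pos (hF hFe), one_mul]
    · rw [if_neg hFe]
      by_cases hTe : e ∈ T
      · rw [if_pos (Finset.mem_sdiff.2 ⟨hTe, hFe⟩), if_pos (hT hTe), if_pos hTe, mul_one]
      · have h1 : e ∉ T \ F := fun h => hTe (Finset.mem_sdiff.1 h).1
        rw [if_neg h1, if_neg hTe, one_mul]

/-- **The per-fibre excess expansion**: on the fibre `(M, C)` at `T ⊆ M`,
`wt_w(C∪T) · wt_{w'}(C∪(M∖T)) = Σ_{F ⊆ T} exc(F) · wt3(M, C, F)` — the `S`-only weight `w_e(1−w'_e) = (w_e − w'_e) + (1−w_e)w'_e`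
split coordinatewise (`Finset.prod_add`). [this work] -/
theorem wt_pair_eq_sum_exc (w w' : Sym2 (Fin n) → unitInterval) {M C T : Finset (Sym2 (Fin n))} (hT : T ⊆ M)
    (hCT : Disjoint C T) :
    wt w (C ∪ T) * wt w' (C ∪ (M \ T)) = ∑ F ∈ T.powerset, (∏ f ∈ F, ((w f : ℝ) - (w' f : ℝ))) *
      (∏ e : Sym2 (Fin n), (if e ∈ C then (w e : ℝ) * (w' e : ℝ) else if e ∈ F then (1 : ℝ) else
        if e ∈ M then (1 - (w e : ℝ)) * (w' e : ℝ) else (1 - (w e : ℝ)) * (1 - (w' e : ℝ)))) := by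
  rw [wt_pair_eq_mul_wt3 w w' hCT]
  have hsplit : (∏ e ∈ T, (w e : ℝ) * (1 - (w' e : ℝ))) =
      ∏ e ∈ T, (((w e : ℝ) - (w' e : ℝ)) + (1 - (w e : ℝ)) * (w' e : ℝ)) :=
    Finset.prod_congr rfl fun e _ => by ring
  rw [hsplit, Finset.prod_add, Finset.sum_mul]
  refine Finset.sum_congr rfl fun F hF => ?_
  rw [Finset.mem_powerset] at hF
  rw [wt3_eq_mul w w' hT hCT hF]
  ring

/-- Nested powerset reindexing: `Σ_{T ⊆ M} Σ_{F ⊆ T} h F T = Σ_{F ⊆ M} Σ_{T₁ ⊆ M∖F} h F (F ∪ T₁)`. [this work] -/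
theorem sum_powerset_powerset_comm {β : Type*} [AddCommMonoid β] {γ : Type*} [DecidableEq γ]
    (M : Finset γ) (h : Finset γ → Finset γ → β) :
    (∑ T ∈ M.powerset, ∑ F ∈ T.powerset, h F T) = ∑ F ∈ M.powerset, ∑ T₁ ∈ (M \ F).powerset, h F (F ∪ T₁) := by
  rw [Finset.sum_sigma', Finset.sum_sigma']
  refine Finset.sum_bij' (fun x _ => ⟨x.2, x.1 \ x.2⟩) (fun x _ => ⟨x.1 ∪ x.2, x.1⟩) ?_ ?_ ?_ ?_ ?_
  · intro x hx
    simp only [Finset.mem_sigma, Finset.mem_powerset] at hx ⊢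
    exact ⟨hx.2.trans hx.1, Finset.sdiff_subset_sdiff hx.1 (subset_refl _)⟩
  · intro x hx
    simp only [Finset.mem_sigma, Finset.mem_powerset] at hx ⊢
    refine ⟨Finset.union_subset hx.1 ((hx.2.trans Finset.sdiff_subset)), Finset.subset_union_left⟩
  · intro x hx
    simp only [Finset.mem_sigma, Finset.mem_powerset] at hx
    ext1
    · exact Finset.union_sdiff_of_subset hx.2
    · rfl
  · intro x hx
    simp only [Finset.mem_sigma, Finset.mem_powerset] at hx
    have hd : Disjoint x.1 x.2 := by
      rw [Finset.disjoint_left]; intro e he1 he2; exact (Finset.mem_sdiff.1 (hx.2 he2)).2 he1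
    have h2 : (x.1 ∪ x.2) \ x.1 = x.2 := by
      rw [Finset.union_sdiff_left, Finset.sdiff_eq_self_iff_disjoint]
      exact hd.symm
    exact Sigma.ext rfl (heq_of_eq h2)
  · intro x hx
    simp only [Finset.mem_sigma, Finset.mem_powerset] at hx
    show h x.2 x.1 = h x.2 (x.2 ∪ x.1 \ x.2)
    rw [Finset.union_sdiff_of_subset hx.2]

/-- **The two-weight fibre expansion** (identity; any kernel, any two weightings):
`Σ_{i,j} κ i j · cell_w i · cell_{w'} j = Σ_M Σ_{C ⊆ Mᶜ} Σ_{F ⊆ M} exc(F) · wt3(M,C,F) · Σ_{T ⊆ M∖F} κ(prof(C∪(F∪T)), prof(C∪((M∖F)∖T)))`.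
[this work] -/
theorem sum_kernel_cell₂_eq_fibres (κ : Fin 15 → Fin 15 → ℤ) (w w' : Sym2 (Fin n) → unitInterval) (a b c y : Fin n) :
    (∑ i : Fin 15, ∑ j : Fin 15, (κ i j : ℝ) * FourPointAtoms.cell w a b c y i * FourPointAtoms.cell w' a b c y j) =
      ∑ M : Finset (Sym2 (Fin n)), ∑ C ∈ (Mᶜ).powerset, ∑ F ∈ M.powerset,
        (∏ f ∈ F, ((w f : ℝ) - (w' f : ℝ))) * (∏ e : Sym2 (Fin n), (if e ∈ C then (w e : ℝ) * (w' e : ℝ) else if e ∈ F then (1 : ℝ) else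
        if e ∈ M then (1 - (w e : ℝ)) * (w' e : ℝ) else (1 - (w e : ℝ)) * (1 - (w' e : ℝ)))) *
          ∑ T ∈ (M \ F).powerset, (liftK κ (prof a b c y ↑(C ∪ (F ∪ T))) (prof a b c y ↑(C ∪ ((M \ F) \ T))) : ℝ) := by
  classical
  rw [sum_kernel_cell₂_eq_pairs, sum_pairs_eq_sum_fibres]
  refine Finset.sum_congr rfl fun M _ => Finset.sum_congr rfl fun C hC => ?_
  rw [Finset.mem_powerset] at hC
  have hCM : Disjoint C M := by
    rw [Finset.disjoint_left]; intro e heC heM; exact (Finset.mem_compl.1 (hC heC)) heM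
  -- expand the pair weight on each point of the fibre
  have h1 : ∀ T ∈ M.powerset,
      (liftK κ (prof a b c y ↑(C ∪ T)) (prof a b c y ↑(C ∪ (M \ T))) : ℝ) * (wt w (C ∪ T) * wt w' (C ∪ (M \ T))) =
        ∑ F ∈ T.powerset, (liftK κ (prof a b c y ↑(C ∪ T)) (prof a b c y ↑(C ∪ (M \ T))) : ℝ) * ((∏ f ∈ F, ((w f : ℝ) - (w' f : ℝ))) *
          (∏ e : Sym2 (Fin n), (if e ∈ C then (w e : ℝ) * (w' e : ℝ) else if e ∈ F then (1 : ℝ) else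
        if e ∈ M then (1 - (w e : ℝ)) * (w' e : ℝ) else (1 - (w e : ℝ)) * (1 - (w' e : ℝ))))) := by
    intro T hT
    rw [Finset.mem_powerset] at hT
    have hCT : Disjoint C T := by
      rw [Finset.disjoint_left]; intro e heC heT; exact (Finset.disjoint_left.1 hCM heC) (hT heT)
    rw [wt_pair_eq_sum_exc w w' hT hCT, Finset.mul_sum]
  rw [Finset.sum_congr rfl h1]
  rw [sum_powerset_powerset_comm M (fun F T =>
    (liftK κ (prof a b c y ↑(C ∪ T)) (prof a b c y ↑(C ∪ (M \ T))) : ℝ) * ((∏ f ∈ F, ((w f : ℝ) - (w' f : ℝ))) *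
      (∏ e : Sym2 (Fin n), (if e ∈ C then (w e : ℝ) * (w' e : ℝ) else if e ∈ F then (1 : ℝ) else
        if e ∈ M then (1 - (w e : ℝ)) * (w' e : ℝ) else (1 - (w e : ℝ)) * (1 - (w' e : ℝ))))))]
  refine Finset.sum_congr rfl fun F _ => ?_
  rw [Finset.mul_sum]
  refine Finset.sum_congr rfl fun T _ => ?_
  rw [show M \ (F ∪ T) = (M \ F) \ T from (sdiff_sdiff_left).symm]
  ring

/-- **Two-weight positivity.**  For a kernel with the two-map property and weightings `w' ≤ w` (coordinatewise), the two-weight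
bilinear cell form with the heavy cells at the bigger weights is nonnegative, on every finite weighted graph and for all marked points.
[this work] -/
theorem sum_kernel_cell₂_nonneg {κ : Fin 15 → Fin 15 → ℤ}
    (hκ : (∀ (γ : Type) [Fintype γ] [DecidableEq γ] (τ σ : Finset γ → Prof),
      (∀ S T : Finset γ, S ⊆ T → ProfLE (τ S) (τ T)) → (∀ S T : Finset γ, S ⊆ T → ProfLE (σ S) (σ T)) →
      (∀ T : Finset γ, ProfLE (σ T) (τ T)) → (∀ T : Finset γ, IsEqv (τ T)) → (∀ T : Finset γ, IsEqv (σ T)) →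
        0 ≤ ∑ T : Finset γ, liftK κ (τ T) (σ Tᶜ)))
    (w w' : Sym2 (Fin n) → unitInterval) (hle : ∀ e, w' e ≤ w e) (a b c y : Fin n) :
    0 ≤ ∑ i : Fin 15, ∑ j : Fin 15, (κ i j : ℝ) * FourPointAtoms.cell w a b c y i * FourPointAtoms.cell w' a b c y j := by
  classical
  rw [sum_kernel_cell₂_eq_fibres]
  refine Finset.sum_nonneg fun M _ => Finset.sum_nonneg fun C hC => Finset.sum_nonneg fun F hF => ?_
  rw [Finset.mem_powerset] at hC hF
  refine mul_nonneg (mul_nonneg (exc_nonneg hle F) (wt3_nonneg w w' M C F)) ?_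
  -- the two-map count on the subsets of `D = M \ F`, via the subtype `↥D`
  set D : Finset (Sym2 (Fin n)) := M \ F with hD
  let emb : Finset ↥D → Finset (Sym2 (Fin n)) := fun T => T.map (Function.Embedding.subtype _)
  let τ : Finset ↥D → Prof := fun T => prof a b c y ↑(C ∪ (F ∪ emb T))
  let σ : Finset ↥D → Prof := fun T => prof a b c y ↑(C ∪ emb T)
  have hemb : ∀ S T : Finset ↥D, S ⊆ T → emb S ⊆ emb T := by
    intro S T hST e he
    simp only [emb, Finset.mem_map, Function.Embedding.coe_subtype] at he ⊢
    obtain ⟨x, hx, rfl⟩ := he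
    exact ⟨x, hST hx, rfl⟩
  have hτ : ∀ S T : Finset ↥D, S ⊆ T → ProfLE (τ S) (τ T) := by
    intro S T hST
    apply prof_mono
    intro e he
    simp only [Finset.coe_union, Set.mem_union, Finset.mem_coe] at he ⊢
    rcases he with he | he | he
    · exact Or.inl he
    · exact Or.inr (Or.inl he)
    · exact Or.inr (Or.inr (hemb S T hST he))
  have hσ : ∀ S T : Finset ↥D, S ⊆ T → ProfLE (σ S) (σ T) := by
    intro S T hST
    apply prof_mono
    intro e he
    simp only [Finset.coe_union, Set.mem_union, Finset.mem_coe] at he ⊢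
    rcases he with he | he
    · exact Or.inl he
    · exact Or.inr (hemb S T hST he)
  have hστ : ∀ T : Finset ↥D, ProfLE (σ T) (τ T) := by
    intro T
    apply prof_mono
    intro e he
    simp only [Finset.coe_union, Set.mem_union, Finset.mem_coe] at he ⊢
    rcases he with he | he
    · exact Or.inl he
    · exact Or.inr (Or.inr he)
  have hτe : ∀ T : Finset ↥D, IsEqv (τ T) := fun T => prof_isEqv a b c y _
  have hσe : ∀ T : Finset ↥D, IsEqv (σ T) := fun T => prof_isEqv a b c y _
  have hgood := hκ (↥D) τ σ hτ hσ hστ hτe hσe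
  have hre : (∑ T : Finset ↥D, liftK κ (τ T) (σ Tᶜ)) =
      ∑ T ∈ D.powerset, liftK κ (prof a b c y ↑(C ∪ (F ∪ T))) (prof a b c y ↑(C ∪ (D \ T))) := by
    refine Finset.sum_bij' (fun T _ => emb T) (fun T _ => T.subtype (· ∈ D)) ?_ ?_ ?_ ?_ ?_
    · intro T _
      rw [Finset.mem_powerset]
      intro e he
      simp only [emb, Finset.mem_map, Function.Embedding.coe_subtype] at he
      obtain ⟨x, _, rfl⟩ := he
      exact x.2
    · intro T _; exact Finset.mem_univ _
    · intro T _
      ext x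
      simp [emb]
    · intro T hT
      rw [Finset.mem_powerset] at hT
      simp only [emb, Finset.subtype_map]
      exact Finset.filter_true_of_mem fun e he => hT he
    · intro T _
      have h1 : emb Tᶜ = D \ emb T := by
        ext e
        simp only [emb, Finset.mem_map, Function.Embedding.coe_subtype, Finset.mem_sdiff, Finset.mem_compl]
        constructor
        · rintro ⟨x, hx, rfl⟩
          exact ⟨x.2, fun ⟨x', hx', he⟩ => hx (by rwa [Subtype.ext he] at hx')⟩
        · rintro ⟨heM, hne⟩
          exact ⟨⟨e, heM⟩, fun h => hne ⟨⟨e, heM⟩, h, rfl⟩, rfl⟩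
      show liftK κ (τ T) (σ Tᶜ) = _
      simp only [τ, σ]
      rw [h1]
  have h := hgood
  rw [hre] at h
  exact_mod_cast h

end TwoCopyMono

end Summit.CriticalPhenomena.PercolationContinuityZ3.Theorems

end
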